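import Literature.AlgebraicGeometry.Modules.CechOrderedComplex
import Literature.AlgebraicGeometry.Modules.SectionsExact
import Literature.AlgebraicGeometry.Modules.LocalExactness
import Literature.Algebra.Homology.IteratedExtClass
import HarnessLib

/-!
# The ordered Čech resolution `0 → M → Č⁰_ord(𝓤, M) → Č¹_ord(𝓤, M) → ⋯` is exact
# (Görtz–Wedhorn II, Prop. 21.69 / Thm. 22.9; Serre FAC §20; Hartshorne III Lemma 4.2)

For a scheme `X`, a finite linearly ordered open cover `𝓤 = (U_i)_{i ∈ ι}` and an `𝒪_X`-module `M`,
the augmented ORDERED sheaf Čech complex of `Modules/CechOrderedComplex` is exact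
(`CechOrd.exactAugmentation`): over an open `V ⊆ U_a` the alternating contraction
`(h c)_t = ε(t ∪ a, a) c_{t ∪ a}` (`t ∌ a`), `= 0` (`t ∋ a`) satisfies `d h + h d = id` in positive
degrees (`CechOrd.d_homotopy_add_homotopy_d`), and in degree `0` a cochain killed by the ordered
differential is killed by the full one, so it is an augmentation by the exactness of the full Čech
resolution of the family of `0`-faces (`Cech.exact_augment`).

* `CechOrd.homotopy`, `CechOrd.d_homotopy_add_homotopy_d` — the contraction and its identity;
* `CechOrd.exact_augmentShortComplex`, `CechOrd.exact_dShortComplex`,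
  **`CechOrd.exactAugmentation U M hcov : ExactAugmentation (CechOrd.complex U M) M`**.

With the acyclicity of the terms (`Modules/CechSheafAcyclic`, basis variant) this makes the ordered
complex compute `Ext(𝒪_X, M)` for affine-localizing `M` (`Modules/CechOrderedComputesCohomology`).
Everything is proved; no named facts.

## References

* U. Görtz, T. Wedhorn, *Algebraic Geometry II: Cohomology of Schemes* (2023), Def. 21.68,
  Prop. 21.69 (p. 260), Thm. 22.9 (p. 332). [GortzWedhorn2023]
* R. Hartshorne, *Algebraic Geometry*, GTM 52 (1977), III Lemma 4.2. [Hartshorne1977]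
* The Stacks Project, Tags 01FG, 01FM (alternating Čech complex computes Čech cohomology). [StacksProject]
-/

noncomputable section

universe u

open CategoryTheory CategoryTheory.Limits Opposite TopologicalSpace AlgebraicGeometry

namespace Literature.AlgebraicGeometry.Modules

namespace CechOrd

variable {X : Scheme.{u}} {ι : Type u} [LinearOrder ι] [Fintype ι] {U : ι → X.Opens} {M : X.Modules}

/-! ### The alternating contraction over an open inside a member of the cover -/

section Homotopy

variable {a : ι} {V : X.Opens} (hV : V ≤ U a)

include hV in
omit [Fintype ι] in
/-- Over `V ⊆ U_a`: `V ∩ U_t ⊆ V ∩ U_{t ∪ a}`. [cite: Hartshorne1977, III Lemma 4.2 (proof)] -/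
lemma inf_face_le_inf_face_insIdx {n : ℕ} (β : Idx ι n) (ha : a ∉ (β 0).1) :
    V ⊓ face (faces U n) β ≤ V ⊓ face (faces U (n + 1)) (insIdx β a ha) := by
  refine le_inf inf_le_left ?_
  rw [face_faces, face_faces, insIdx_val, faceSet_insert]
  exact le_inf (inf_le_left.trans hV) inf_le_right

/-- **The alternating contraction** `h : Čⁿ⁺¹_ord(V) → Čⁿ_ord(V)` over `V ⊆ U_a`:
`(h c)_t = ε(t ∪ a, a) c_{t ∪ a}|` for `a ∉ t`, and `0` for `a ∈ t`.
[cite: GortzWedhorn2023, Prop. 21.69 (p. 260)] [cite: Hartshorne1977, III Lemma 4.2 (proof)] -/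
def homotopy (n : ℕ) (c : Cech.Sections (faces U (n + 1)) 0 M V) : Cech.Sections (faces U n) 0 M V :=
  fun β => if h : a ∈ (β 0).1 then 0 else
    sgn (Insert.insert a (β 0).1) a • Cech.res M (inf_face_le_inf_face_insIdx hV β h) (c (insIdx β a h))

omit [Fintype ι] in
/-- The contraction vanishes on simplices containing `a`. [cite: GortzWedhorn2023, Prop. 21.69 (p. 260)] -/
lemma homotopy_apply_of_mem (n : ℕ) (c : Cech.Sections (faces U (n + 1)) 0 M V) (β : Idx ι n)
    (h : a ∈ (β 0).1) : homotopy hV n c β = 0 := dif_pos h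

omit [Fintype ι] in
/-- The contraction on simplices not containing `a`. [cite: GortzWedhorn2023, Prop. 21.69 (p. 260)] -/
lemma homotopy_apply_of_not_mem (n : ℕ) (c : Cech.Sections (faces U (n + 1)) 0 M V) (β : Idx ι n)
    (h : a ∉ (β 0).1) : homotopy hV n c β = sgn (Insert.insert a (β 0).1) a •
      Cech.res M (inf_face_le_inf_face_insIdx hV β h) (c (insIdx β a h)) := dif_neg h

omit [Fintype ι] in
/-- The contraction kills `0`. [cite: GortzWedhorn2023, Prop. 21.69 (p. 260)] -/
@[simp] lemma homotopy_zero (n : ℕ) : homotopy hV n (0 : Cech.Sections (faces U (n + 1)) 0 M V) = 0 := by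
  funext β
  by_cases h : a ∈ (β 0).1
  · exact homotopy_apply_of_mem hV n 0 β h
  · rw [homotopy_apply_of_not_mem hV n 0 β h, Cech.zero_apply, map_zero, smul_zero, Cech.zero_apply]

omit [Fintype ι] in
/-- The contraction kills the zero section of `Čⁿ⁺¹_ord`. [cite: GortzWedhorn2023, Prop. 21.69 (p. 260)] -/
lemma homotopy_zero' (n : ℕ) : homotopy hV n (0 : Γ(obj U M (n + 1), V)) = 0 := homotopy_zero hV n

/-- **The homotopy identity `d(hc) + h(dc) = c`** on `(n+1)`-cochains over `V ⊆ U_a`: at `t ∋ a` only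
the face `t ∖ a` of `d(hc)` survives and gives `ε(t,a)² c_t = c_t`; at `t ∌ a` the term `x = a` of
`h(dc)_t = ε(t∪a, a) (dc)_{t∪a}` gives `c_t` and the terms `x ∈ t` cancel against `d(hc)_t` by
`ε(s,a)ε(s,x) + ε(s∖a,x)ε(s∖x,a) = 0`, `s = t ∪ a`. [cite: GortzWedhorn2023, Prop. 21.69 (p. 260)]
[cite: Hartshorne1977, III Lemma 4.2 (proof)] -/
theorem d_homotopy_add_homotopy_d (n : ℕ) (c : Cech.Sections (faces U (n + 1)) 0 M V)
    (τ : Idx ι (n + 1)) :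
    ((d U M n).app V (homotopy hV n c) : Cech.Sections (faces U (n + 1)) 0 M V) τ +
      homotopy hV (n + 1) ((d U M (n + 1)).app V c) τ = c τ := by
  rw [d_app_apply]
  by_cases haτ : a ∈ (τ 0).1
  · -- `t ∋ a`: `h(dc)_t = 0`, `d(hc)_t = ε(t,a) (hc)_{t∖a} = c_t`
    rw [homotopy_apply_of_mem hV (n + 1) _ τ haτ, add_zero, Finset.sum_eq_single a]
    · have hna : a ∉ (delIdx τ a haτ 0).1 := by rw [delIdx_val]; exact Finset.notMem_erase a _
      have e : insIdx (delIdx τ a haτ) a hna = τ := Idx.ext (by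
        rw [insIdx_val, delIdx_val, Finset.insert_erase haτ])
      rw [faceFun_apply_of_mem _ _ _ _ _ _ _ haτ, homotopy_apply_of_not_mem hV n c _ hna, map_zsmul,
        smul_smul, Cech.res_res]
      have hs : sgn (Insert.insert a (delIdx τ a haτ 0).1) a = sgn (τ 0).1 a := by
        rw [delIdx_val, Finset.insert_erase haτ]
      rw [hs, sgn_mul_self, one_smul, res_apply_congr U M c e _ (le_refl _), Cech.res_self]
    · intro x _ hxa
      by_cases hx : x ∈ (τ 0).1
      · have hax : a ∈ (delIdx τ x hx 0).1 := by
          rw [delIdx_val]; exact Finset.mem_erase.mpr ⟨Ne.symm hxa, haτ⟩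
        rw [faceFun_apply_of_mem _ _ _ _ _ _ _ hx, homotopy_apply_of_mem hV n c _ hax, map_zero, smul_zero]
      · exact faceFun_apply_of_not_mem _ _ _ _ _ _ _ hx
    · intro h; exact absurd (Finset.mem_univ a) h
  · -- `t ∌ a`: `s = t ∪ a`
    rw [homotopy_apply_of_not_mem hV (n + 1) _ τ haτ, d_app_apply, map_sum, Finset.smul_sum,
      ← Finset.sum_add_distrib, Finset.sum_eq_single a]
    · -- the term `x = a`: `0 + ε(s,a) ε(s,a) c_{s ∖ a} = c_t`
      have has : a ∈ (insIdx τ a haτ 0).1 := by rw [insIdx_val]; exact Finset.mem_insert_self a _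
      have e : delIdx (insIdx τ a haτ) a has = τ := Idx.ext (by
        rw [delIdx_val, insIdx_val, Finset.erase_insert haτ])
      rw [faceFun_apply_of_not_mem _ _ _ _ _ _ _ haτ, zero_add, faceFun_apply_of_mem _ _ _ _ _ _ _ has,
        map_zsmul, smul_smul, Cech.res_res, res_apply_congr U M c e _ (le_refl _), Cech.res_self]
      change (sgn (Insert.insert a (τ 0).1) a * sgn (Insert.insert a (τ 0).1) a) • c τ = c τ
      rw [sgn_mul_self, one_smul]
    · intro x _ hxa
      by_cases hx : x ∈ (τ 0).1
      · -- `x ∈ t`, `x ≠ a`: the two terms cancel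
        have hax : a ∉ (delIdx τ x hx 0).1 := by
          rw [delIdx_val]; exact fun h => haτ (Finset.mem_of_mem_erase h)
        have hxs : x ∈ (insIdx τ a haτ 0).1 := by rw [insIdx_val]; exact Finset.mem_insert_of_mem hx
        have e : insIdx (delIdx τ x hx) a hax = delIdx (insIdx τ a haτ) x hxs := Idx.ext (by
          rw [insIdx_val, delIdx_val, delIdx_val, insIdx_val, Finset.erase_insert_of_ne (Ne.symm hxa)])
        rw [faceFun_apply_of_mem _ _ _ _ _ _ _ hx, homotopy_apply_of_not_mem hV n c _ hax, map_zsmul,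
          smul_smul, Cech.res_res, faceFun_apply_of_mem _ _ _ _ _ _ _ hxs, map_zsmul, smul_smul,
          Cech.res_res,
          res_apply_congr U M c e _ ((inf_face_le_inf_face_insIdx hV τ haτ).trans
            (inf_face_le U V (insIdx τ a haτ) (delIdx (insIdx τ a haτ) x hxs) (Finset.erase_subset _ _))),
          ← add_smul]
        change (sgn (τ 0).1 x * sgn (Insert.insert a ((τ 0).1.erase x)) a +
            sgn (Insert.insert a (τ 0).1) a * sgn (Insert.insert a (τ 0).1) x) • _ = _
        have key : sgn (τ 0).1 x * sgn (Insert.insert a ((τ 0).1.erase x)) a +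
            sgn (Insert.insert a (τ 0).1) a * sgn (Insert.insert a (τ 0).1) x = 0 := by
          have h := sgn_mul_sgn_add_sgn_erase_mul (s := Insert.insert a (τ 0).1)
            (Finset.mem_insert_self a _) (Finset.mem_insert_of_mem hx) (Ne.symm hxa)
          rw [Finset.erase_insert haτ, Finset.erase_insert_of_ne (Ne.symm hxa)] at h
          rw [add_comm]; exact h
        rw [key, zero_smul]
      · -- `x ∉ t`, `x ≠ a`: both terms vanish
        have hxs : x ∉ (insIdx τ a haτ 0).1 := by
          rw [insIdx_val]
          exact fun h => (Finset.mem_insert.mp h).elim hxa hx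
        rw [faceFun_apply_of_not_mem _ _ _ _ _ _ _ hx, faceFun_apply_of_not_mem _ _ _ _ _ _ _ hxs, map_zero,
          smul_zero, add_zero]
    · intro h; exact absurd (Finset.mem_univ a) h

end Homotopy

/-! ### Exactness of the augmented ordered Čech complex for a cover -/

variable (U M) (hcov : ⨆ i, U i = ⊤)

include hcov in
omit [Fintype ι] in
/-- The `0`-faces cover `X`. [cite: Hartshorne1977, III Lemma 4.2] -/
lemma iSup_faces_zero_eq_top : iSup (faces U 0) = ⊤ := by rw [iSup_faces_zero]; exact hcov

/-- **Degree `0` over `V ⊆ U_a`: a `0`-cochain killed by `d` is the augmentation of `c_{{a}}|_V`**: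
`(d c)_{{a,i}} = ± (c_{{i}}| - c_{{a}}|) = 0` on `V ∩ U_a ∩ U_i = V ∩ U_i`.
[cite: Hartshorne1977, III Lemma 4.2 (proof)] [cite: GortzWedhorn2023, Prop. 21.69 (p. 260)] -/
theorem eq_augment_of_d_eq_zero {a : ι} {V : X.Opens} (hV : V ≤ U a) (c : Cech.Sections (faces U 0) 0 M V)
    (hc : (d U M 0).app V c = 0) :
    ∃ x : Γ(M, V), ∀ β : Idx ι 0, Cech.res M (inf_le_left : V ⊓ face (faces U 0) β ≤ V) x = c β := by
  let α₀ : Idx ι 0 := fun _ => ⟨{a}, Finset.card_singleton a⟩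
  have hVa : V ≤ V ⊓ face (faces U 0) α₀ := by
    refine le_inf le_rfl ?_
    rw [face_faces]
    exact le_iInf₂ fun j hj => by
      rw [Finset.mem_singleton.mp hj]; exact hV
  refine ⟨Cech.res M hVa (c α₀), fun β => ?_⟩
  obtain ⟨i, hi⟩ := Finset.card_eq_one.mp (β 0).2
  rw [Cech.res_res]
  by_cases hia : i = a
  · subst hia
    have e : α₀ = β := Idx.ext (by change ({i} : Finset ι) = (β 0).1; rw [hi])
    rw [res_apply_congr U M c e (inf_le_left.trans hVa) (le_refl _), Cech.res_self]
  · have hai : a ∉ (β 0).1 := by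
      rw [hi, Finset.mem_singleton]; exact Ne.symm hia
    -- the `1`-simplex `{a, i}` and the component of `d c = 0` there
    have hγ : ((d U M 0).app V c : Cech.Sections (faces U 1) 0 M V) (insIdx β a hai) = 0 := by
      rw [hc, Cech.obj_zero_apply]
    have hmem_a : a ∈ (insIdx β a hai 0).1 := by rw [insIdx_val]; exact Finset.mem_insert_self a _
    have hmem_i : i ∈ (insIdx β a hai 0).1 := by
      rw [insIdx_val, hi]; exact Finset.mem_insert_of_mem (Finset.mem_singleton_self i)
    have e_a : delIdx (insIdx β a hai) a hmem_a = β :=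
      Idx.ext (by rw [delIdx_val, insIdx_val, Finset.erase_insert hai])
    have e_i : delIdx (insIdx β a hai) i hmem_i = α₀ :=
      Idx.ext (by
        rw [delIdx_val, insIdx_val, hi, Finset.erase_insert_of_ne (Ne.symm hia), Finset.erase_singleton]
        rfl)
    rw [d_app_apply, Fintype.sum_eq_add a i (Ne.symm hia) (fun x hx => faceFun_apply_of_not_mem _ _ _ _ _ _ _
        (by rw [insIdx_val, hi]; intro h
            rcases Finset.mem_insert.mp h with h | h
            · exact hx.1 h
            · exact hx.2 (Finset.mem_singleton.mp h))),
      faceFun_apply_of_mem _ _ _ _ _ _ _ hmem_a, faceFun_apply_of_mem _ _ _ _ _ _ _ hmem_i] at hγ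
    -- restrict the relation to `V ∩ U_β ⊆ V ∩ U_{a,i}`
    have hγ' := congrArg (Cech.res M (inf_face_le_inf_face_insIdx hV β hai)) hγ
    rw [map_add, map_zsmul, map_zsmul, Cech.res_res, Cech.res_res, map_zero,
      res_apply_congr U M c e_a _ (le_refl _), Cech.res_self,
      res_apply_congr U M c e_i _ (inf_le_left.trans hVa), insIdx_val, hi] at hγ'
    rcases lt_or_gt_of_ne (Ne.symm hia : a ≠ i) with h | h
    · rw [(sgn_pair h).1, (sgn_pair h).2, one_smul, neg_one_smul, ← sub_eq_add_neg, sub_eq_zero] at hγ'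
      exact hγ'.symm
    · rw [Finset.pair_comm, (sgn_pair h).1, (sgn_pair h).2, one_smul, neg_one_smul, add_comm,
        ← sub_eq_add_neg, sub_eq_zero] at hγ'
      exact hγ'

include hcov in
/-- Local exactness at the augmentation. [cite: Hartshorne1977, III Lemma 4.2] -/
theorem augment_locally_exact (V : X.Opens) (s : Γ(obj U M 0, V)) (hs : (d U M 0).app V s = 0)
    (x : X) (hx : x ∈ V) :
    ∃ (W : X.Opens) (i : W ⟶ V), x ∈ W ∧
      ∃ t : Γ(M, W), (augment U M).app W t = (obj U M 0).presheaf.map i.op s := by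
  obtain ⟨a, ha⟩ := Cech.exists_mem U hcov x
  refine ⟨V ⊓ U a, homOfLE inf_le_left, ⟨hx, ha⟩, ?_⟩
  have hs' : (d U M 0).app (V ⊓ U a) (Cech.res (obj U M 0) inf_le_left s) = 0 := by
    rw [Cech.app_res, hs]; exact map_zero _
  obtain ⟨y, hy⟩ := eq_augment_of_d_eq_zero U M (inf_le_right : V ⊓ U a ≤ U a) _ hs'
  exact ⟨y, funext hy⟩

include hcov in
/-- Local exactness in positive degrees: `s = d(hs) + h(ds) = d(hs)` over `V ∩ U_a`.
[cite: Hartshorne1977, III Lemma 4.2] [cite: GortzWedhorn2023, Prop. 21.69 (p. 260)] -/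
theorem d_locally_exact (n : ℕ) (V : X.Opens) (s : Γ(obj U M (n + 1), V))
    (hs : (d U M (n + 1)).app V s = 0) (x : X) (hx : x ∈ V) :
    ∃ (W : X.Opens) (i : W ⟶ V), x ∈ W ∧
      ∃ t : Γ(obj U M n, W), (d U M n).app W t = (obj U M (n + 1)).presheaf.map i.op s := by
  obtain ⟨a, ha⟩ := Cech.exists_mem U hcov x
  refine ⟨V ⊓ U a, homOfLE inf_le_left, ⟨hx, ha⟩, ?_⟩
  have hV : V ⊓ U a ≤ U a := inf_le_right
  have hs' : (d U M (n + 1)).app (V ⊓ U a) (Cech.res (obj U M (n + 1)) inf_le_left s) = 0 := by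
    rw [Cech.app_res, hs]; exact map_zero _
  refine ⟨homotopy hV n (Cech.res (obj U M (n + 1)) inf_le_left s), funext fun τ => ?_⟩
  have h := d_homotopy_add_homotopy_d hV n (Cech.res (obj U M (n + 1)) inf_le_left s) τ
  rw [hs', homotopy_zero' hV (n + 1), Cech.zero_apply, add_zero] at h
  exact h

/-- The augmentation short complex `M → Č⁰_ord → Č¹_ord`. [cite: Hartshorne1977, III Lemma 4.2] -/
abbrev augmentShortComplex : ShortComplex X.Modules :=
  ShortComplex.mk (augment U M) (d U M 0) (augment_d U M)

/-- The pieces `Čⁿ_ord → Čⁿ⁺¹_ord → Čⁿ⁺²_ord`. [cite: GortzWedhorn2023, Def. 21.68 (p. 260)] -/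
abbrev dShortComplex (n : ℕ) : ShortComplex X.Modules :=
  ShortComplex.mk (d U M n) (d U M (n + 1)) (d_comp_d U M n)

include hcov in
/-- **Exactness at the augmentation** for a cover. [cite: Hartshorne1977, III Lemma 4.2] -/
theorem exact_augmentShortComplex : (augmentShortComplex U M).Exact :=
  exact_of_locally_exact _ fun V s hs x hx => augment_locally_exact U M hcov V s hs x hx

include hcov in
/-- **Exactness in positive degrees** for a cover. [cite: GortzWedhorn2023, Prop. 21.69 (p. 260)] -/
theorem exact_dShortComplex (n : ℕ) : (dShortComplex U M n).Exact :=
  exact_of_locally_exact _ fun V s hs x hx => d_locally_exact U M hcov n V s hs x hx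

/-- **The ordered Čech resolution**: for a finite linearly ordered open cover `𝓤`, the augmented
ordered sheaf Čech complex `0 → M → Č⁰_ord(𝓤, M) → Č¹_ord(𝓤, M) → ⋯` is exact.
[cite: GortzWedhorn2023, Prop. 21.69 (p. 260) and Thm. 22.9 (p. 332)] [cite: Hartshorne1977, III Lemma 4.2] -/
def exactAugmentation : Literature.Algebra.Homology.ExactAugmentation (complex U M) M where
  ε := augment U M
  ε_d := augment_complex_d U M
  mono_ε := Cech.mono_augment (faces U 0) M (iSup_faces_zero_eq_top U hcov)
  exact₀ := by
    refine (ShortComplex.exact_iff_of_iso ?_).mp (exact_augmentShortComplex U M hcov)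
    exact ShortComplex.isoMk (Iso.refl _) (Iso.refl _) (Iso.refl _)
      (by exact (Category.id_comp _).trans (Category.comp_id _).symm)
      (by exact (Category.id_comp _).trans ((complex_d U M 0).trans (Category.comp_id _).symm))
  exactAt_succ n := by
    rw [(complex U M).exactAt_iff' n (n + 1) (n + 2) (CochainComplex.prev_nat_succ n)
      (CochainComplex.next ℕ (n + 1))]
    refine (ShortComplex.exact_iff_of_iso ?_).mp (exact_dShortComplex U M hcov n)
    exact ShortComplex.isoMk (Iso.refl _) (Iso.refl _) (Iso.refl _)
      (by change 𝟙 _ ≫ (complex U M).d n (n + 1) = d U M n ≫ 𝟙 _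
          rw [complex_d]; exact (Category.id_comp _).trans (Category.comp_id _).symm)
      (by change 𝟙 _ ≫ (complex U M).d (n + 1) (n + 2) = d U M (n + 1) ≫ 𝟙 _
          rw [complex_d]; exact (Category.id_comp _).trans (Category.comp_id _).symm)

/-- The augmentation of the ordered Čech resolution is `CechOrd.augment`. [cite: Hartshorne1977, III Lemma 4.2] -/
@[simp] lemma exactAugmentation_ε : (exactAugmentation U M hcov).ε = augment U M := rfl

end CechOrd

end Literature.AlgebraicGeometry.Modules

end
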